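import Summits.RiemannHypothesis.RiemannHypothesis.Theorems.Splittings.CostumeDetectorsScrewII
import HarnessLib

/-!
# Splittings — screw costume detectors III: the SHAPE tails of the pivot ladder, part 2/2 (B20 ratio tails, B21/B22
# concavity / convexity, B17 deficit band, B23 determinant signs, B24 matrix-side thinning) — zero-definition raw form

Cell rh-split, seat rh-split-screw-neg g2 (brief sha16 f79c5f09d8bcb036), card `run/shared/lean/pub/rh-split/cards/SPLIT-screw-neg.md`
§10; continues `CostumeDetectorsScrewII.lean` (engine, B19, B18).

Family equivalence of record: `IntegerScrew.riemannHypothesis_iff_screwPivot_pos : RH ↔ ∀ M ≥ 2, 0 < screwPivot M`.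
Vocabulary (spelled out): FIN(H) = `∀ M, 2 ≤ M → M ≤ H → 0 < d_M`; TAIL(H) = `∀ M, H < M → 0 < d_M`; AllPos =
`∀ M ≥ 2, 0 < d_M` (↔ RH); the SHAPE tails above a cut `H`: non-decreasing / non-increasing / ratio `θ·d_M ≤ d_{M+1}` /
power-weighted `M^α d_M` non-decreasing / concave / convex / deficit band `M·(2Ψ(h_M) − d_M)·log M ≤ ε`; determinant
signs `screwDet n > 0 / ≥ 0 / ≠ 0`.

ENGINE (two tree inputs, both RH-free given positive definiteness): the log envelope `screwPivot_le_log_div`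
(`S_{M−1} ≻ 0 ⟹ d_M ≤ (log M + 4)/(M − 1)`, hence under AllPos `M·d_M ≤ (3/2)(log M + 4)`) and the arithmetic deficit
floor `deficit_mul_log_ge` (`S_{M−1} ≻ 0, M ≥ 122 ⟹ M·(2Ψ(h_M) − d_M)·log M ≥ log²2 − 57/(M−2)`); analytic core
`exists_envelope_lt_rpow` (`(3/2)(log M + 4) < c·M^β` at some level above any cut).

ROWS in this part:
* B20 `θ·d_M ≤ d_{M+1}` above `H`: VALID with `FIN(H+1)` for `θ > 0`; `θ ≥ 1` ⟹ `¬RH` (outright false for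
  `H ≤ 511`); `θ < 1` kernel-undecided.
* B21 concave tail ⟹ (AllPos → non-decreasing tail) ⟹ `¬RH` for every `H`; B22 convex tail ∧ RH ⟹ non-increasing tail
  (= B7; kernel-undecided; not a conjunct).
* B17 deficit band `M·(2Ψ(h_M) − d_M)·log M ≤ ε` above `H`: REFUTED outright for `121 ≤ H ≤ 512` whenever
  `ε < log²2 − 57/(H−1)`; RH-INCONSISTENT for every `H` and every `ε < log²2`.
* B23 determinant relabelling `(∀ n, 0 < screwDet n) ↔ RH`, `RH ↔ (∀ n, 0 ≤ screwDet n) ∧ (∀ n, screwDet n ≠ 0)`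
  (each conjunct RH-implied, neither decided alone: parity / singular-coincidence loophole in determinant clothes).
* B24 matrix-side thinning is VALID and FIN-free: `RH ↔ ∀ k, S_{f k} ≻ 0` for any cofinal `f`,
  `RH ↔ ∀ n ≥ k₀, S_n ≻ 0` for every `k₀` (contrast: pivot thinning, g0 B15, is invalid bookkeeping).

Provenance: zero-definition raw form (the 13 seat-local Props `FinPiv`/`TailPiv`/`AllPos`/`NondecTail`/`NonincTail`/
`RatioTail`/`PowNondecTail`/`ConcaveTail`/`ConvexTail`/`DeficitBandTail`/`DetPos`/`DetNonneg`/`DetNonzero` SPELLED OUT;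
proofs verbatim) of `HOME/rh-split-screw-neg/SplitScrewNegG2.lean` (sha16 183b9d0f3c69f0ba, 503 lines), filed in two
parts (`CostumeDetectorsScrewII` = engine + B19 + B18, `CostumeDetectorsScrewIII` = B20–B24) by rh-split-typer-1 g2
(lead HANDOFF §8, optional item «raw-ify + split ≤ 400 → CostumeDetectorsScrew II»).  Referee (rh-split-ref g0)
addendum 20:02Z on cards/SPLIT-screw-neg.md §10: replay rc 0, std on `not_powNondecTail_of_le_511` +
`not_rh_of_deficitBandTail`; «band numbers and the B19/B20/B21/B22 propagation arguments re-checked on paper;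
α-dichotomy (boundary α = 1 = B8) endorsed; class UNCHANGED barrier note, 0 new survivors».  Typer replay: farm rc 0,
0 warnings, 0 sorry, std axioms.

HONEST LABEL: SPLITTING SEARCH over kernel-typed RH-EQUIVALENCES; a splitting A ∧ B ⟹ RH is CONDITIONAL
bookkeeping unless A and B are both proved; nothing here bears on the truth of RH.
-/

noncomputable section

set_option linter.dupNamespace false

namespace Summit.RiemannHypothesis.RiemannHypothesis.Theorems.Splittings.CostumeDetectorsScrewIII

open Literature.NumberTheory.LFunctions
open Summit.RiemannHypothesis.RiemannHypothesis.Theorems.IntegerScrew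
open Summit.RiemannHypothesis.RiemannHypothesis.Theses.IntegerScrew
open Summit.RiemannHypothesis.RiemannHypothesis.Theorems.Splittings.CostumeDetectorsScrewII

/-! ## B20: ratio tails `θ·d_M ≤ d_{M+1}` -/

/-- VALID as a conjunct for every `θ > 0`. -/
theorem allPos_of_fin_ratioTail {θ : ℝ} (hθ : 0 < θ) (H : ℕ) (hH : 1 ≤ H) (hA : (∀ M : ℕ, 2 ≤ M → M ≤ (H + 1) → 0 < screwPivot M))
    (hB : (∀ M : ℕ, H < M → (θ) * screwPivot M ≤ screwPivot (M + 1))) : (∀ M : ℕ, 2 ≤ M → 0 < screwPivot M) := by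
  have hpos : ∀ n : ℕ, 0 < screwPivot (H + 1 + n) := by
    intro n
    induction n with
    | zero => simpa using hA (H + 1) (by omega) le_rfl
    | succ n ih =>
      have h := hB (H + 1 + n) (by omega)
      have he : H + 1 + (n + 1) = H + 1 + n + 1 := by omega
      rw [he]
      exact lt_of_lt_of_le (mul_pos hθ ih) h
  intro M hM
  rcases Nat.lt_or_ge (H + 1) M with hlt | hle
  · obtain ⟨n, rfl⟩ : ∃ n, M = H + 1 + n := ⟨M - (H + 1), by omega⟩
    exact hpos n
  · exact hA M hM hle

/-- B20 VALID as a conjunct for `θ > 0`: `FIN(H+1) ∧ (θ·d_M ≤ d_{M+1} above H) ⟹ RH`. -/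
theorem rh_of_fin_ratioTail {θ : ℝ} (hθ : 0 < θ) (H : ℕ) (hH : 1 ≤ H) (hA : (∀ M : ℕ, 2 ≤ M → M ≤ (H + 1) → 0 < screwPivot M))
    (hB : (∀ M : ℕ, H < M → (θ) * screwPivot M ≤ screwPivot (M + 1))) : _root_.RiemannHypothesis :=
  allPos_iff_rh.mp (allPos_of_fin_ratioTail hθ H hH hA hB)

/-- For `θ ≥ 1` a ratio tail is a non-decreasing tail (given AllPos). -/
theorem nondecTail_of_ratioTail_of_allPos {θ : ℝ} (hθ : 1 ≤ θ) (hall : (∀ M : ℕ, 2 ≤ M → 0 < screwPivot M)) (H : ℕ)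
    (hB : (∀ M : ℕ, H < M → (θ) * screwPivot M ≤ screwPivot (M + 1))) : (∀ M : ℕ, (max H 1) < M → screwPivot M ≤ screwPivot (M + 1)) := by
  intro M hM
  have hd : 0 ≤ screwPivot M := (hall M (by omega)).le
  have h := hB M (by omega)
  nlinarith

/-- **B20, `θ ≥ 1`: RH-INCONSISTENT for every cut** (and so never a useful conjunct). -/
theorem not_rh_of_ratioTail {θ : ℝ} (hθ : 1 ≤ θ) (H : ℕ) (hB : (∀ M : ℕ, H < M → (θ) * screwPivot M ≤ screwPivot (M + 1))) :
    ¬ _root_.RiemannHypothesis := fun hRH =>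
  not_rh_of_nondecTail _ (nondecTail_of_ratioTail_of_allPos hθ (allPos_iff_rh.mpr hRH) H hB) hRH

/-- **B20, `θ ≥ 1`: REFUTED outright for `H ≤ 511`.** -/
theorem not_ratioTail_of_le_511 {θ : ℝ} (hθ : 1 ≤ θ) (H : ℕ) (hH : H ≤ 511) : ¬ (∀ M : ℕ, H < M → (θ) * screwPivot M ≤ screwPivot (M + 1)) := by
  intro hB
  have hall : (∀ M : ℕ, 2 ≤ M → 0 < screwPivot M) :=
    allPos_of_fin_ratioTail (by linarith) (max H 1) (le_max_right _ _)
      (fun M hM hMH => finPiv_512 M hM (by omega)) (fun M hM => hB M (by omega))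
  exact not_rh_of_ratioTail hθ H hB (allPos_iff_rh.mp hall)

/-! ## B21 / B22: concavity and convexity of the pivot sequence -/

/-- A concave positive tail is non-decreasing: a single down-step would propagate linearly to `−∞`. -/
theorem nondecTail_of_concaveTail_of_allPos (H : ℕ) (hC : (∀ M : ℕ, H < M → screwPivot (M + 2) - screwPivot (M + 1) ≤ screwPivot (M + 1) - screwPivot M)) (hall : (∀ M : ℕ, 2 ≤ M → 0 < screwPivot M)) :
    (∀ M : ℕ, (max H 1) < M → screwPivot M ≤ screwPivot (M + 1)) := by
  intro M hM
  by_contra hlt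
  push Not at hlt
  set δ : ℝ := screwPivot M - screwPivot (M + 1) with hδ
  have hδpos : 0 < δ := by rw [hδ]; linarith
  have hinc : ∀ n : ℕ,
      screwPivot (M + n + 1) - screwPivot (M + n) ≤ screwPivot (M + 1) - screwPivot M := by
    intro n
    induction n with
    | zero => simp
    | succ n ih =>
      have h := hC (M + n) (by omega)
      rw [show M + (n + 1) + 1 = M + n + 2 by omega, show M + (n + 1) = M + n + 1 by omega]
      linarith
  have hlin : ∀ n : ℕ, screwPivot (M + n) ≤ screwPivot M - n * δ := by
    intro n
    induction n with
    | zero => simp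
    | succ n ih =>
      have h := hinc n
      rw [show M + (n + 1) = M + n + 1 by omega]
      push_cast
      linarith
  obtain ⟨n, hn⟩ := exists_nat_gt (screwPivot M / δ)
  have hn' : screwPivot M < n * δ := by rwa [div_lt_iff₀ hδpos] at hn
  have hposn := hall (M + n) (by omega)
  have hle := hlin n
  linarith

/-- **B21: a concave pivot tail is RH-INCONSISTENT for every cut** (under RH it would be a
non-decreasing tail, B18). It is not a valid conjunct either (concavity gives no positivity). -/
theorem not_rh_of_concaveTail (H : ℕ) (hC : (∀ M : ℕ, H < M → screwPivot (M + 2) - screwPivot (M + 1) ≤ screwPivot (M + 1) - screwPivot M)) : ¬ _root_.RiemannHypothesis :=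
  fun hRH => not_rh_of_nondecTail _
    (nondecTail_of_concaveTail_of_allPos H hC (allPos_iff_rh.mpr hRH)) hRH

/-- A convex tail under `AllPos` is non-increasing: a single up-step would propagate linearly to
`+∞`, against the envelope `d_M ≤ 3`. -/
theorem nonincTail_of_convexTail_of_allPos (H : ℕ) (hC : (∀ M : ℕ, H < M → screwPivot (M + 1) - screwPivot M ≤ screwPivot (M + 2) - screwPivot (M + 1))) (hall : (∀ M : ℕ, 2 ≤ M → 0 < screwPivot M)) :
    (∀ M : ℕ, H < M → screwPivot (M + 1) ≤ screwPivot M) := by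
  intro M hM
  by_contra hlt
  push Not at hlt
  set δ : ℝ := screwPivot (M + 1) - screwPivot M with hδ
  have hδpos : 0 < δ := by rw [hδ]; linarith
  have hinc : ∀ n : ℕ, δ ≤ screwPivot (M + n + 1) - screwPivot (M + n) := by
    intro n
    induction n with
    | zero => simp [hδ]
    | succ n ih =>
      have h := hC (M + n) (by omega)
      rw [show M + (n + 1) + 1 = M + n + 2 by omega, show M + (n + 1) = M + n + 1 by omega]
      linarith
  have hlin : ∀ n : ℕ, screwPivot M + n * δ ≤ screwPivot (M + n) := by
    intro n
    induction n with
    | zero => simp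
    | succ n ih =>
      have h := hinc n
      rw [show M + (n + 1) = M + n + 1 by omega]
      push_cast
      linarith
  obtain ⟨k, hk⟩ := exists_nat_gt ((3 - screwPivot M) / δ)
  have hk' : 3 - screwPivot M < k * δ := by rwa [div_lt_iff₀ hδpos] at hk
  have h1 := hlin (k + 2)
  have h2 := pivot_le_three_of_allPos hall (M + (k + 2)) (by omega)
  push_cast at h1
  have h3 : ((k : ℝ) + 2) * δ = k * δ + 2 * δ := by ring
  linarith

/-- **B22: under RH a convex pivot tail is a non-increasing tail (B7)** — so convexity tails are
B7-strength: kernel-undecided, data-refuted at small cuts, not a conjunct. -/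
theorem nonincTail_of_convexTail_of_rh (hRH : _root_.RiemannHypothesis) (H : ℕ) (hC : (∀ M : ℕ, H < M → screwPivot (M + 1) - screwPivot M ≤ screwPivot (M + 2) - screwPivot (M + 1))) :
    (∀ M : ℕ, H < M → screwPivot (M + 1) ≤ screwPivot M) :=
  nonincTail_of_convexTail_of_allPos H hC (allPos_iff_rh.mpr hRH)

/-! ## B17: deficit-band tails -/

/-- **B17: REFUTED outright for `121 ≤ H` given `FIN(H)`, for every `ε < log²2 − 57/(H−1)`**:
at the first level above the cut the base makes `S_H ≻ 0` and the arithmetic deficit floor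
`deficit_mul_log_ge` exceeds the band. -/
theorem not_deficitBandTail (H : ℕ) (h121 : 121 ≤ H) (hA : (∀ M : ℕ, 2 ≤ M → M ≤ H → 0 < screwPivot M)) {ε : ℝ}
    (hε : ε < Real.log 2 ^ 2 - 57 / ((H : ℝ) - 1)) : ¬ (∀ M : ℕ, H < M → (M : ℝ) * (2 * zetaScrew (Real.log ((M : ℝ) / ((M : ℝ) - 1))) - screwPivot M) * Real.log M ≤ (ε)) := by
  intro hB
  have hPD : (screwMatrix (H - 1)).PosDef :=
    screwMatrix_posDef_of_screwPivot_pos_le (H - 1) (fun M hM hMH => hA M hM (by omega))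
      (H - 1) le_rfl
  have hidx : H + 1 - 2 = H - 1 := by omega
  have hdef := deficit_mul_log_ge (H + 1) (by omega) (by rw [hidx]; exact hPD)
  have hB1 := hB (H + 1) (by omega)
  have hcast : ((H + 1 : ℕ) : ℝ) - 2 = (H : ℝ) - 1 := by push_cast; ring
  rw [hcast] at hdef
  linarith

/-- B17 REFUTED outright for `121 ≤ H ≤ 512`, `ε < log²2 − 57/(H−1)`. -/
theorem not_deficitBandTail_of_le_512 (H : ℕ) (h121 : 121 ≤ H) (h512 : H ≤ 512) {ε : ℝ}
    (hε : ε < Real.log 2 ^ 2 - 57 / ((H : ℝ) - 1)) : ¬ (∀ M : ℕ, H < M → (M : ℝ) * (2 * zetaScrew (Real.log ((M : ℝ) / ((M : ℝ) - 1))) - screwPivot M) * Real.log M ≤ (ε)) :=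
  not_deficitBandTail H h121 (fun M hM hMH => finPiv_512 M hM (by omega)) hε

/-- Numerical instance: at the certified frontier `H = 512` every band `ε ≤ 0.368` is refuted. -/
theorem not_deficitBandTail_512 {ε : ℝ} (hε : ε ≤ 0.368) : ¬ (∀ M : ℕ, 512 < M → (M : ℝ) * (2 * zetaScrew (Real.log ((M : ℝ) / ((M : ℝ) - 1))) - screwPivot M) * Real.log M ≤ (ε)) := by
  apply not_deficitBandTail_of_le_512 512 (by norm_num) le_rfl
  have hl2 : 0.6931471803 < Real.log 2 := Real.log_two_gt_d9
  have h57 : (57 : ℝ) / (((512 : ℕ) : ℝ) - 1) = 57 / 511 := by norm_num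
  rw [h57]
  nlinarith [mul_pos (sub_pos.mpr hl2) (sub_pos.mpr hl2)]

/-- **B17: RH-INCONSISTENT for every cut and every `ε < log²2`.** -/
theorem not_rh_of_deficitBandTail {ε : ℝ} (hε : ε < Real.log 2 ^ 2) (H : ℕ)
    (hB : (∀ M : ℕ, H < M → (M : ℝ) * (2 * zetaScrew (Real.log ((M : ℝ) / ((M : ℝ) - 1))) - screwPivot M) * Real.log M ≤ (ε))) : ¬ _root_.RiemannHypothesis := by
  intro hRH
  have hgap : 0 < Real.log 2 ^ 2 - ε := by linarith
  obtain ⟨N, hN⟩ := exists_nat_gt (57 / (Real.log 2 ^ 2 - ε))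
  have hN' : 57 < N * (Real.log 2 ^ 2 - ε) := by rwa [div_lt_iff₀ hgap] at hN
  set H' : ℕ := max H 121 + N + 2 with hH'
  have hNH : ((N + 2 : ℕ) : ℝ) ≤ (H' : ℝ) := by exact_mod_cast (show N + 2 ≤ H' by omega)
  push_cast at hNH
  have hH1 : (0 : ℝ) < (H' : ℝ) - 1 := by linarith
  have h57 : 57 / ((H' : ℝ) - 1) < Real.log 2 ^ 2 - ε := by
    rw [div_lt_iff₀ hH1]
    nlinarith [mul_le_mul_of_nonneg_left hNH hgap.le]
  exact not_deficitBandTail H' (by omega) (fun M hM _ => (allPos_iff_rh.mpr hRH) M hM)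
    (by linarith) (fun M hM => hB M (by omega)) 

/-! ## B23: the determinant relabelling and the sign/non-vanishing split -/

/-- B23: all leading principal minors positive ⟺ RH (Sylvester; determinant clothes of the pivot criterion). -/
theorem detPos_iff_rh : (∀ n : ℕ, 0 < screwDet n) ↔ _root_.RiemannHypothesis := by
  rw [riemannHypothesis_iff_screwMatrix_posDef]
  constructor
  · intro h n
    refine screwMatrix_posDef_of_screwPivot_pos (fun M hM => ?_) n
    obtain ⟨k, rfl⟩ : ∃ k, M = k + 2 := ⟨M - 2, by omega⟩
    rw [screwPivot_add_two]
    exact div_pos (h (k + 1)) (h k)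
  · intro h n
    exact screwDet_pos_of_posDef (h n)

/-- RH ⟹ all minors `≥ 0`. -/
theorem detNonneg_of_rh (hRH : _root_.RiemannHypothesis) : (∀ n : ℕ, 0 ≤ screwDet n) :=
  fun n => (detPos_iff_rh.mpr hRH n).le

/-- RH ⟹ all minors `≠ 0`. -/
theorem detNonzero_of_rh (hRH : _root_.RiemannHypothesis) : (∀ n : ℕ, screwDet n ≠ 0) :=
  fun n => (detPos_iff_rh.mpr hRH n).ne'

/-- `RH ↔ (all minors ≥ 0) ∧ (all minors ≠ 0)`: both conjuncts RH-implied; neither is decided alone in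
the kernel (sign-only = parity loophole `n₋ ∈ 2ℕ`; non-vanishing-only = no singular coincidence). -/
theorem rh_iff_detNonneg_and_detNonzero : _root_.RiemannHypothesis ↔ (∀ n : ℕ, 0 ≤ screwDet n) ∧ (∀ n : ℕ, screwDet n ≠ 0) :=
  ⟨fun h => ⟨detNonneg_of_rh h, detNonzero_of_rh h⟩,
    fun h => detPos_iff_rh.mp fun n => lt_of_le_of_ne (h.1 n) (h.2 n).symm⟩

/-! ## B24: matrix-side thinning and matrix-side tails are FIN-free RH-equivalences -/

/-- Positive definiteness along ANY cofinal sequence of sizes is RH (nestedness). -/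
theorem rh_iff_posDef_along (f : ℕ → ℕ) (hf : ∀ n, ∃ k, n ≤ f k) :
    _root_.RiemannHypothesis ↔ ∀ k, (screwMatrix (f k)).PosDef := by
  rw [riemannHypothesis_iff_screwMatrix_posDef]
  refine ⟨fun h k => h (f k), fun h n => ?_⟩
  obtain ⟨k, hk⟩ := hf n
  exact screwMatrix_posDef_of_le hk (h k)

/-- The matrix-side tail is RH at EVERY threshold, with no finite conjunct: the tail absorbs FIN. -/
theorem rh_iff_posDef_tail (k₀ : ℕ) :
    _root_.RiemannHypothesis ↔ ∀ n, k₀ ≤ n → (screwMatrix n).PosDef := by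
  rw [riemannHypothesis_iff_screwMatrix_posDef]
  refine ⟨fun h n _ => h n, fun h n => ?_⟩
  rcases Nat.lt_or_ge n k₀ with hlt | hge
  · exact screwMatrix_posDef_of_le hlt.le (h k₀ le_rfl)
  · exact h n hge

end Summit.RiemannHypothesis.RiemannHypothesis.Theorems.Splittings.CostumeDetectorsScrewIII

end
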